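import Literature.Computability.Complexity.PRGDerandomization
import Literature.Computability.Complexity.HardnessVsRandomnessTests
import Literature.Computability.Complexity.UniformDerandomizationDistinguishers
import HarnessLib

/-!
# IW98, Case 1 (BFNW): a `SIZE(N)`-pseudorandom table generator fools the witness tests
# `r ↦ [⟨x, r⟩ ∈ L']` — `|vote − truth| ≤ 1/N` (the fooling step of `IWUniform.IOPRGAt`)

Literature / complexity — derandomization. Step (d) of hypothesis `h₁` of
`impagliazzoWigderson1998_of_generators` (`UniformDerandomizationAssembly.lean`; Case 1 of Impagliazzo–Wigderson
1998 = Babai–Fortnow–Nisan–Wigderson 1993): the tree's generator of IKW Thm. 11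
(`IKW2002_thm11_tableGenerator`, `IKWGeneratorsProofs.lean`: `tableGenerator F f k N` is
`SIZE(N)`-pseudorandom when the table `f` is hard) fools, at such a length, the one-sided tests of
the development: for a witness language `L' ∈ P/poly` whose paired slices have `B₂`-circuits of size
`s(n, m)` (`exists_cktSize_boolPair_of_mem_PPoly`), every instance `x ∈ {0,1}ⁿ` and coin length
`m ≤ N` with `s + 2 ≤ N`,

  `|vote L' g k x − truth L' m x| ≤ 1/N`,   `g σ = (F ⟨tt f, ⟨1^N, σ⟩⟩) ↾ᴰ m`

(`IWUniform.abs_vote_sub_truth_le_of_isSizePseudorandom`) — Arora–Barak's Lemma 20.3 at one length,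
with the hard-wired test circuit `exists_circuit_hardwire` (`PRGDerandomization.lean`) and the
conversions between strings and bit vectors of `PRGDerandomization.lean` /
`HardnessVsRandomnessTests.lean`, exactly as in the tree's `IKWSim.abs_accCount_sub_le` (the `MA` case).
Everything is proved; the only definition is the string form `IWUniform.tableGen` of the generator.

## References

* [ImpagliazzoWigderson2001] JCSS 63 (2001), §2.1, first paragraph (Case `EXP ⊄ P/poly`, [BFNW93]).
* [AroraBarakCC2009] CUP 2009, Lemma 20.3 (proof), Def. 20.2.
* [ImpagliazzoKabanetsWigderson2002] JCSS 65 (2002), Thm. 11 and §2.4 (the generator `G_r(s) = F(r, s)`).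
-/

noncomputable section

namespace Literature.Computability.Complexity

namespace IWUniform

open _root_.Computability Finset MetaComplexity

/-- **The table generator as a string function**: seeds `σ` (strings of `k` bits) to the first `m`
output bits, `σ ↦ (F ⟨truthTable f, ⟨1^N, σ⟩⟩) ↾ᴰ m` (padded with `0`s if short — the string form of
`tableGenerator F f k N` read on its first `m ≤ N` coordinates). [cite: ImpagliazzoKabanetsWigderson2002, Thm. 11] -/
def tableGen {M : ℕ} (F : List Bool → List Bool) (f : (Fin M → Bool) → Bool) (N m : ℕ) :
    List Bool → List Bool :=
  fun σ => List.takeD m (F (boolPair (truthTable f) (boolPair (unaryEncodeNat N) σ))) false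

/-- The first `m ≤ N` coordinates of `tableGenerator` on the seed `z` list as `tableGen` on `ofFn z`.
[folklore] -/
theorem ofFn_tableGenerator_castLE {M : ℕ} (F : List Bool → List Bool) (f : (Fin M → Bool) → Bool)
    {k N m : ℕ} (hmN : m ≤ N) (z : Fin k → Bool) :
    (List.ofFn fun j : Fin m => tableGenerator F f k N z (Fin.castLE hmN j)) =
      tableGen F f N m (List.ofFn z) := by
  rw [tableGen, ← ofFn_getD_eq_takeD]
  simp [tableGenerator]

/-- **The fooling step of Case 1** (Arora–Barak Lemma 20.3 at one length): if the paired slices of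
`L'` on `n + m` bits have `B₂`-circuits of size `s`, the table generator on `k`-bit seeds with `N`
output bits is `SIZE(N)`-pseudorandom, `m ≤ N` and `s + 2 ≤ N`, then for every `x ∈ {0,1}ⁿ` the seed
vote of the test `r ↦ [⟨x, r⟩ ∈ L']` is within `1/N` of its true acceptance probability on `m` coins.
[cite: AroraBarakCC2009, Lemma 20.3 (proof)] [cite: ImpagliazzoWigderson2001, §2.1, first paragraph] -/
theorem abs_vote_sub_truth_le_of_isSizePseudorandom {L' : Language Bool} {n m s : ℕ}
    (hck : CktSize B2 (fun (w : Fin n ⊕ Fin m → Bool) (_ : Unit) =>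
      L'.boolIndicator (boolPair (List.ofFn fun i => w (.inl i)) (List.ofFn fun j => w (.inr j)))) s)
    {M : ℕ} (F : List Bool → List Bool) (f : (Fin M → Bool) → Bool) {k N : ℕ}
    (hps : IsSizePseudorandom (tableGenerator F f k N)) (hmN : m ≤ N) (hsN : s + 2 ≤ N)
    (x : List Bool) (hx : x.length = n) :
    |vote L' (tableGen F f N m) k x - truth L' m x| ≤ 1 / N := by
  classical
  obtain ⟨C, hB, hsize, hC⟩ := exists_circuit_hardwire hck x hx hmN
  have hadv := hps C hB (hsize.trans hsN)
  unfold prgAdvantage at hadv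
  -- the seed side is the vote
  have c1 : (univ.filter fun z : Fin k → Bool => C.eval (tableGenerator F f k N z) = true).card =
      cnt k {σ | boolPair x (tableGen F f N m σ) ∈ L'} := by
    rw [← card_filter_ofFn_mem_eq_cnt]
    refine congrArg Finset.card (Finset.filter_congr fun z _ => ?_)
    rw [hC, ofFn_tableGenerator_castLE, ← Set.mem_iff_boolIndicator]
    exact Iff.rfl
  have e1 : ((univ.filter fun z : Fin k → Bool => C.eval (tableGenerator F f k N z) = true).card : ℝ) / 2 ^ k =
      vote L' (tableGen F f N m) k x := by
    rw [vote, uniformProb_eq_cnt_div, c1]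
  -- the uniform side is the truth
  have hf : (univ.filter fun y : Fin N → Bool => C.eval y = true) =
      univ.filter fun u : Fin N → Bool =>
        (fun v : Fin m → Bool => boolPair x (List.ofFn v) ∈ L') (fun j => u (Fin.castLE hmN j)) := by
    refine Finset.filter_congr fun y _ => ?_
    rw [hC, ← Set.mem_iff_boolIndicator]
    exact Iff.rfl
  have c2 : (univ.filter fun v : Fin m → Bool => boolPair x (List.ofFn v) ∈ L').card =
      cnt m {r | boolPair x r ∈ L'} :=
    card_filter_ofFn_mem_eq_cnt m {r | boolPair x r ∈ L'}
  have e2 : ((univ.filter fun y : Fin N → Bool => C.eval y = true).card : ℝ) / 2 ^ N = truth L' m x := by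
    rw [hf, card_filter_comp_castLE_div hmN (fun v : Fin m → Bool => boolPair x (List.ofFn v) ∈ L'),
      truth, uniformProb_eq_cnt_div, c2]
  rwa [e1, e2] at hadv

end IWUniform

end Literature.Computability.Complexity

end
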